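import Literature.Algebra.EuclideanLattices.KhotExplicitReduction
import Literature.Computability.Complexity.AOWListMatrix
import HarnessLib

/-!
# Khot 2005, §6–7 at list level: the boosted, padded, squared output matrix as a table

Topic `Algebra/EuclideanLattices`, namespace `Literature.Algebra.EuclideanLattices.Khot`. Support file
for the MACHINE hypothesis of `gapSVP_const_isNPHardRandomized_of_prop6_of_FP_explicit`
(`KhotExplicitReduction.lean`: some `F ∈ FP` computes `⟨code I, c⟩ ↦ code (khotOutputExplicit k I c)`).
The output instance of Khot's reduction (`KhotAssembly.khotInstance`) is
`columnInstance (squareOf (outMatrix B₀ W k (basePad e₀) Kpad) eR eC)`: the `k`-fold boosted basis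
`augPowMatrix B₀ W k` of the base basis `B₀` (§6–7), padded by `Kpad · e_o` on the rows
`augPad (basePad e₀) k`, re-indexed to a square matrix by the explicit enumerations `eR`, `eC` of
`khotDataExplicit`, and transposed (column convention). This file writes that matrix as a
FUNCTIONAL PROGRAM on lists of rows of integers (`LMat`: `ent`, `tab`, `toMat` of
`AOWListMatrix.lean`) and proves the program correct; the program is what the typed poly-time algebra
`CodeFP` then computes on codes (sequel files). No machines here, no new facts.

* `kronL` (Kronecker product of tables, `ent_kronL`), `ent_append_left/right` (vertical stacking),
  `ent_oneL'`;
* `augPowTab r c B0 W j` — level `0` is `W • B0`, level `j+1` is `[B0 ⊗ I ; B0 ⊗ augPowTab j]` — and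
  **`ent_augPowTab`**: through `outEquivFin`/`coefEquivFin` its entries ARE `augPowMatrix B W j`
  (`augPowMatrix_zero_apply`, `augPowMatrix_succ_inl`, `augPowMatrix_succ_inr`: the recursion of the
  boosted basis, `B ⊗ [αI ; B_j]` of §6.2, entrywise);
* `growthL` = `growth` (`growthL_eq_growth`), `padRows` = the padded rows in the order of `padEquivFin`
  (`getD_padRows`), `padTab`, `hcatL`, `trL`, and **`toMat_outTab`**: the final table is the transpose of
  `squareOf (outMatrix B₀ W k (basePad e₀) Kpad) eR eC` for the explicit `eR`, `eC`.

## References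

* S. Khot, *Hardness of approximating the shortest vector problem in lattices*, J. ACM 52 (2005)
  789–808, §6.2 (augmented tensor product, basis `B ⊗ [αI ; B']`), §7 (Eq. (2)), §7.3.
* S. Arora, B. Barak, *Computational Complexity: A Modern Approach*, CUP 2009, §1.3.
-/

namespace Literature.Algebra.EuclideanLattices.Khot

open Literature.Computability.Complexity Literature.Computability.Complexity.LMat Finset Matrix

/-! ### Generic tables: Kronecker products, stacking, identity -/

section Generic

/-- **Kronecker product of list matrices**: `X` is `R₁ × C₁`, `Y` is `R₂ × C₂`; entry
`(b + R₂ a, d + C₂ c)` of the `(R₁R₂) × (C₁C₂)` result is `X a c · Y b d` (the order of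
`finProdFinEquiv`). [folklore] -/
def kronL (R₁ C₁ R₂ C₂ : ℕ) (X Y : List (List ℤ)) : List (List ℤ) :=
  tab (R₁ * R₂) (C₁ * C₂) fun I J => ent X (I / R₂) (J / C₂) * ent Y (I % R₂) (J % C₂)

/-- `b + n·a < m·n` for `a < m`, `b < n`. [folklore] -/
theorem add_mul_lt {a b m n : ℕ} (ha : a < m) (hb : b < n) : b + n * a < m * n := by
  calc b + n * a < n + n * a := by omega
    _ = n * (a + 1) := by ring
    _ ≤ n * m := Nat.mul_le_mul_left n ha
    _ = m * n := Nat.mul_comm n m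

/-- Entries of a Kronecker product. [folklore] -/
theorem ent_kronL {R₁ C₁ R₂ C₂ : ℕ} (X Y : List (List ℤ)) {a b c d : ℕ} (ha : a < R₁) (hb : b < R₂)
    (hc : c < C₁) (hd : d < C₂) :
    ent (kronL R₁ C₁ R₂ C₂ X Y) (b + R₂ * a) (d + C₂ * c) = ent X a c * ent Y b d := by
  rw [kronL, ent_tab _ (add_mul_lt ha hb) (add_mul_lt hc hd)]
  have hR : 0 < R₂ := by omega
  have hC : 0 < C₂ := by omega
  rw [Nat.add_mul_div_left _ _ hR, Nat.add_mul_div_left _ _ hC, Nat.div_eq_of_lt hb, Nat.div_eq_of_lt hd,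
    Nat.add_mul_mod_self_left, Nat.add_mul_mod_self_left, Nat.mod_eq_of_lt hb, Nat.mod_eq_of_lt hd]
  simp

/-- The Kronecker table has `R₁R₂` rows. [folklore] -/
theorem length_kronL (R₁ C₁ R₂ C₂ : ℕ) (X Y : List (List ℤ)) : (kronL R₁ C₁ R₂ C₂ X Y).length = R₁ * R₂ :=
  length_tab _ _ _

/-- Entries of a vertical stack, upper block. [folklore] -/
theorem ent_append_left {X Y : List (List ℤ)} {i : ℕ} (hi : i < X.length) (j : ℕ) :
    ent (X ++ Y) i j = ent X i j := by
  unfold ent; rw [List.getD_append _ _ _ _ hi]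

/-- Entries of a vertical stack, lower block. [folklore] -/
theorem ent_append_right {X Y : List (List ℤ)} {i : ℕ} (hi : X.length ≤ i) (j : ℕ) :
    ent (X ++ Y) i j = ent Y (i - X.length) j := by
  unfold ent; rw [List.getD_append_right _ _ _ _ hi]

/-- Entries of the identity table. [folklore] -/
theorem ent_oneL' {N i j : ℕ} (hi : i < N) (hj : j < N) : ent (oneL N) i j = if i = j then 1 else 0 := by
  rw [oneL, ent_tab _ hi hj]

/-- Scaling a table: `W • X` on an `R × C` window. [folklore] -/
def smulL (R C : ℕ) (W : ℤ) (X : List (List ℤ)) : List (List ℤ) := tab R C fun i j => W * ent X i j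

/-- Entries of a scaled table. [folklore] -/
theorem ent_smulL {R C : ℕ} (W : ℤ) (X : List (List ℤ)) {i j : ℕ} (hi : i < R) (hj : j < C) :
    ent (smulL R C W X) i j = W * ent X i j := by
  rw [smulL, ent_tab _ hi hj]

end Generic

/-! ### Values of the explicit enumerations -/

section EquivValues

variable {m n : Type} {r c d : ℕ}

/-- `coefEquivFin en 0 = en`. [folklore] -/
theorem coefEquivFin_zero_val (en : n ≃ Fin c) (x : n) : (coefEquivFin en 0 x : ℕ) = en x := rfl

/-- `coefEquivFin en (j+1) (i, cf) = coefEquivFin en j cf + c^{j+1} · en i`. [folklore] -/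
theorem coefEquivFin_succ_val (en : n ≃ Fin c) (j : ℕ) (i : n) (cf : Coef n j) :
    (coefEquivFin en (j + 1) (i, cf) : ℕ) = coefEquivFin en j cf + c ^ (j + 1) * en i := by
  simp [coefEquivFin]

/-- `outEquivFin em en 0 = em`. [folklore] -/
theorem outEquivFin_zero_val (em : m ≃ Fin r) (en : n ≃ Fin c) (x : m) :
    (outEquivFin em en 0 x : ℕ) = em x := rfl

/-- Side-block rows: `outEquivFin (j+1) (inl (p, cf)) = coefEquivFin j cf + c^{j+1} · em p`. [folklore] -/
theorem outEquivFin_succ_inl_val (em : m ≃ Fin r) (en : n ≃ Fin c) (j : ℕ) (p : m) (cf : Coef n j) :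
    (outEquivFin em en (j + 1) (Sum.inl (p, cf)) : ℕ) = coefEquivFin en j cf + c ^ (j + 1) * em p := by
  show ((finSumFinEquiv (Sum.inl (finProdFinEquiv (em p, coefEquivFin en j cf))) :
    Fin (r * c ^ (j + 1) + r * outCard r c j)) : ℕ) = _
  rw [finSumFinEquiv_apply_left, Fin.val_castAdd, finProdFinEquiv_apply_val]

/-- Main-block rows: `outEquivFin (j+1) (inr (p, o)) = r·c^{j+1} + (outEquivFin j o + outCard r c j · em p)`.
[folklore] -/
theorem outEquivFin_succ_inr_val (em : m ≃ Fin r) (en : n ≃ Fin c) (j : ℕ) (p : m) (o : Out m n j) :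
    (outEquivFin em en (j + 1) (Sum.inr (p, o)) : ℕ) =
      r * c ^ (j + 1) + (outEquivFin em en j o + outCard r c j * em p) := by
  show ((finSumFinEquiv (Sum.inr (finProdFinEquiv (em p, outEquivFin em en j o))) :
    Fin (r * c ^ (j + 1) + r * outCard r c j)) : ℕ) = _
  rw [finSumFinEquiv_apply_right, Fin.val_natAdd, finProdFinEquiv_apply_val]

/-- `padEquivFin 0 = ep`. [folklore] -/
theorem padEquivFin_zero_val (em : m ≃ Fin r) (en : n ≃ Fin c) {p₀ : m → Prop} (ep : {x : m // p₀ x} ≃ Fin d)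
    (z : {o : Out m n 0 // augPad (n := n) p₀ 0 o}) : (padEquivFin em en ep 0 z : ℕ) = ep z := rfl

/-- Side-block padding rows: `padEquivFin (j+1) ⟨inl (x, cf), h⟩ = coefEquivFin j cf + c^{j+1} · ep ⟨x, h⟩`.
[folklore] -/
theorem padEquivFin_succ_inl_val (em : m ≃ Fin r) (en : n ≃ Fin c) {p₀ : m → Prop}
    (ep : {x : m // p₀ x} ≃ Fin d) (j : ℕ) (x : m) (cf : Coef n j) (h : p₀ x) :
    (padEquivFin em en ep (j + 1) ⟨Sum.inl (x, cf), h⟩ : ℕ) = coefEquivFin en j cf + c ^ (j + 1) * ep ⟨x, h⟩ := by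
  show ((finSumFinEquiv (Sum.inl (finProdFinEquiv (ep ⟨x, h⟩, coefEquivFin en j cf))) :
    Fin (d * c ^ (j + 1) + r * outCard r c j)) : ℕ) = _
  rw [finSumFinEquiv_apply_left, Fin.val_castAdd, finProdFinEquiv_apply_val]

/-- Main-block padding rows: `padEquivFin (j+1) ⟨inr (p, o), _⟩ = d·c^{j+1} + (outEquivFin j o + outCard r c j · em p)`.
[folklore] -/
theorem padEquivFin_succ_inr_val (em : m ≃ Fin r) (en : n ≃ Fin c) {p₀ : m → Prop}
    (ep : {x : m // p₀ x} ≃ Fin d) (j : ℕ) (p : m) (o : Out m n j)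
    (h : augPad (n := n) p₀ (j + 1) (Sum.inr (p, o))) :
    (padEquivFin em en ep (j + 1) ⟨Sum.inr (p, o), h⟩ : ℕ) =
      d * c ^ (j + 1) + (outEquivFin em en j o + outCard r c j * em p) := by
  show ((finSumFinEquiv (Sum.inr (finProdFinEquiv (em p, outEquivFin em en j o))) :
    Fin (d * c ^ (j + 1) + r * outCard r c j)) : ℕ) = _
  rw [finSumFinEquiv_apply_right, Fin.val_natAdd, finProdFinEquiv_apply_val]

end EquivValues

/-! ### Entries of the boosted basis, recursively -/

section AugPowEntries

variable {m n : Type} [Fintype n] [DecidableEq n]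

/-- Level `0`: `augPowMatrix B W 0 = W • B`. [cite: Khot2005, §6.2 and §7 Eq. (2)] -/
theorem augPowMatrix_zero_apply (B : Matrix m n ℤ) (W : ℤ) (o : m) (cf : n) :
    augPowMatrix B W 0 o cf = W * B o cf := by
  simp [augPowMatrix, augPow]

/-- The coefficient matrix of a coordinate vector `e_{(i₀, c₀)}` pushed through `B`:
`(B · X)_{p, c'} = B_{p i₀} · [c' = c₀]`. [cite: Khot2005, §6.2] -/
theorem mul_of_single (B : Matrix m n ℤ) (j : ℕ) (i₀ : n) (c₀ : Coef n j) (p : m) (c' : Coef n j) :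
    (B * Matrix.of fun i c => (Pi.single (i₀, c₀) (1 : ℤ) : n × Coef n j → ℤ) (i, c)) p c' =
      B p i₀ * if c' = c₀ then 1 else 0 := by
  rw [Matrix.mul_apply, Finset.sum_eq_single i₀]
  · simp only [Matrix.of_apply, Pi.single_apply, Prod.mk.injEq, true_and]
  · intro i _ hi
    simp [Pi.single_apply, hi]
  · intro h; exact absurd (Finset.mem_univ i₀) h

/-- Level `j+1`, side block: `augPowMatrix B W (j+1) (inl (p, c')) (i₀, c₀) = B_{p i₀} · [c' = c₀]`
(the block `B ⊗ I`). [cite: Khot2005, §6.2] -/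
theorem augPowMatrix_succ_inl (B : Matrix m n ℤ) (W : ℤ) (j : ℕ) (p : m) (c' : Coef n j) (i₀ : n)
    (c₀ : Coef n j) :
    augPowMatrix B W (j + 1) (Sum.inl (p, c')) (i₀, c₀) = B p i₀ * if c' = c₀ then 1 else 0 := by
  rw [augPowMatrix, Matrix.of_apply, augPow, Sum.elim_inl, mul_of_single]

/-- Level `j+1`, main block: `augPowMatrix B W (j+1) (inr (p, o')) (i₀, c₀) = B_{p i₀} · augPowMatrix B W j o' c₀`
(the block `B ⊗ B_j`). [cite: Khot2005, §6.2] -/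
theorem augPowMatrix_succ_inr (B : Matrix m n ℤ) (W : ℤ) (j : ℕ) (p : m) (o' : Out m n j) (i₀ : n)
    (c₀ : Coef n j) :
    augPowMatrix B W (j + 1) (Sum.inr (p, o')) (i₀, c₀) = B p i₀ * augPowMatrix B W j o' c₀ := by
  rw [augPowMatrix, Matrix.of_apply, augPow, Sum.elim_inr, augPowMatrix, Matrix.of_apply]
  have h : (B * Matrix.of fun i c => (Pi.single (i₀, c₀) (1 : ℤ) : n × Coef n j → ℤ) (i, c)) p =
      B p i₀ • (Pi.single c₀ (1 : ℤ) : Coef n j → ℤ) := by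
    funext c
    rw [mul_of_single, Pi.smul_apply, smul_eq_mul, Pi.single_apply]
  rw [h, augPow_smul, Pi.smul_apply, smul_eq_mul]

end AugPowEntries

/-! ### The boosted basis as a table -/

section AugPowTab

/-- **The boosted basis as a functional program**: level `0` is `W • B0` (an `r × c` window), level
`j+1` is the vertical stack of `B0 ⊗ I_{c^{j+1}}` and `B0 ⊗ (level j)` — the basis
`B ⊗ [αI ; B_j]` of §6.2 rescaled by `W = 1/α`, in the row order of `outEquivFin` and the column
order of `coefEquivFin`. [cite: Khot2005, §6.2 and §7 Eq. (2)] -/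
def augPowTab (r c : ℕ) (B0 : List (List ℤ)) (W : ℤ) : ℕ → List (List ℤ)
  | 0 => smulL r c W B0
  | j + 1 => kronL r c (c ^ (j + 1)) (c ^ (j + 1)) B0 (oneL (c ^ (j + 1))) ++
      kronL r c (outCard r c j) (c ^ (j + 1)) B0 (augPowTab r c B0 W j)

/-- The level-`j` table has `outCard r c j` rows. [folklore] -/
theorem length_augPowTab (r c : ℕ) (B0 : List (List ℤ)) (W : ℤ) :
    ∀ j : ℕ, (augPowTab r c B0 W j).length = outCard r c j
  | 0 => length_tab _ _ _
  | j + 1 => by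
    rw [augPowTab, List.length_append, length_kronL, length_kronL]
    rfl

variable {m n : Type} [Fintype n] [DecidableEq n] {r c : ℕ}

/-- **The program computes the boosted basis**: through the explicit enumerations, the entries of
`augPowTab r c B0 W j` are those of `augPowMatrix B W j`, provided `B0` holds `B`.
[cite: Khot2005, §6.2 and §7 Eq. (2)] -/
theorem ent_augPowTab (em : m ≃ Fin r) (en : n ≃ Fin c) (B : Matrix m n ℤ) (B0 : List (List ℤ))
    (hB : ∀ p i, ent B0 (em p) (en i) = B p i) (W : ℤ) :
    ∀ (j : ℕ) (o : Out m n j) (cf : Coef n j),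
      ent (augPowTab r c B0 W j) (outEquivFin em en j o) (coefEquivFin en j cf) = augPowMatrix B W j o cf
  | 0, o, cf => by
    rw [outEquivFin_zero_val, coefEquivFin_zero_val, augPowTab, ent_smulL W B0 (em o).isLt (en cf).isLt, hB,
      augPowMatrix_zero_apply]
  | j + 1, Sum.inl (p, c'), (i₀, c₀) => by
    have hlen : (kronL r c (c ^ (j + 1)) (c ^ (j + 1)) B0 (oneL (c ^ (j + 1)))).length = r * c ^ (j + 1) :=
      length_kronL _ _ _ _ _ _
    have hrow : (outEquivFin em en (j + 1) (Sum.inl (p, c')) : ℕ) < r * c ^ (j + 1) := by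
      rw [outEquivFin_succ_inl_val]; exact add_mul_lt (em p).isLt (coefEquivFin en j c').isLt
    rw [augPowTab, ent_append_left (hlen ▸ hrow), outEquivFin_succ_inl_val, coefEquivFin_succ_val,
      ent_kronL _ _ (em p).isLt (coefEquivFin en j c').isLt (en i₀).isLt (coefEquivFin en j c₀).isLt, hB,
      ent_oneL' (coefEquivFin en j c').isLt (coefEquivFin en j c₀).isLt, augPowMatrix_succ_inl]
    congr 1
    simp only [Fin.val_eq_val, EmbeddingLike.apply_eq_iff_eq]
  | j + 1, Sum.inr (p, o'), (i₀, c₀) => by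
    have hlen : (kronL r c (c ^ (j + 1)) (c ^ (j + 1)) B0 (oneL (c ^ (j + 1)))).length = r * c ^ (j + 1) :=
      length_kronL _ _ _ _ _ _
    have hrow : r * c ^ (j + 1) ≤ (outEquivFin em en (j + 1) (Sum.inr (p, o')) : ℕ) := by
      rw [outEquivFin_succ_inr_val]; exact Nat.le_add_right _ _
    rw [augPowTab, ent_append_right (hlen ▸ hrow), hlen, outEquivFin_succ_inr_val, Nat.add_sub_cancel_left,
      coefEquivFin_succ_val,
      ent_kronL _ _ (em p).isLt (outEquivFin em en j o').isLt (en i₀).isLt (coefEquivFin en j c₀).isLt, hB,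
      ent_augPowTab em en B B0 hB W j o' c₀, augPowMatrix_succ_inr]

end AugPowTab

/-! ### Growth, padding rows, the square table -/

section Square

/-- **The growth of a table** on an `R × C` window: `∑_{i<R} ∑_{j<C} |X i j|` (`Khot.growth` of the
matrix it holds). [folklore] -/
def growthL (R C : ℕ) (X : List (List ℤ)) : ℤ := sumRange R fun i => sumRange C fun j => |ent X i j|

/-- The growth of a table is the growth of its matrix, through any enumerations. [folklore] -/
theorem growthL_eq_growth {Ro Co : Type} [Fintype Ro] [Fintype Co] {R C : ℕ} (eR : Ro ≃ Fin R) (eC : Co ≃ Fin C)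
    (X : List (List ℤ)) (A : Matrix Ro Co ℤ) (hX : ∀ o z, ent X (eR o) (eC z) = A o z) :
    growthL R C X = growth A := by
  unfold growthL growth
  rw [sumRange_eq_sum]
  rw [← eR.sum_comp]
  refine Finset.sum_congr rfl fun o _ => ?_
  rw [sumRange_eq_sum, ← eC.sum_comp]
  exact Finset.sum_congr rfl fun z _ => by rw [hX]

/-- **The padded rows, listed in the order of `padEquivFin`** (base rows `≃ Fin r`, padded base rows
`≃ Fin d` with `ep z + 1 = em z`, i.e. the universe rows `1, …, u-1` of Khot's base): level `0` is
`[1, …, d]`; level `j+1` is `[t + c^{j+1} | t < d·c^{j+1}]` then `[r·c^{j+1} + t' | t' < r · outCard r c j]`.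
[folklore] -/
def padRows (r c d : ℕ) : ℕ → List ℕ
  | 0 => (List.range d).map (· + 1)
  | j + 1 => (List.range (d * c ^ (j + 1))).map (· + c ^ (j + 1)) ++
      (List.range (r * outCard r c j)).map (· + r * c ^ (j + 1))

/-- `|padRows r c d j| = padCard r c d j`. [folklore] -/
theorem length_padRows (r c d : ℕ) : ∀ j : ℕ, (padRows r c d j).length = padCard r c d j
  | 0 => by simp [padRows, padCard]
  | j + 1 => by simp [padRows, padCard]

variable {m n : Type} {r c d : ℕ}

/-- **`padRows` lists the padded rows**: entry `padEquivFin j z` of `padRows r c d j` is the row index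
`outEquivFin j z` — provided the base padding enumeration is `ep z = em z - 1` on rows `em z ≥ 1`.
[folklore] -/
theorem getD_padRows (em : m ≃ Fin r) (en : n ≃ Fin c) {p₀ : m → Prop} (ep : {x : m // p₀ x} ≃ Fin d)
    (hep : ∀ z, (ep z : ℕ) + 1 = em z.val) :
    ∀ (j : ℕ) (z : {o : Out m n j // augPad (n := n) p₀ j o}),
      (padRows r c d j).getD (padEquivFin em en ep j z) 0 = outEquivFin em en j z.val
  | 0, z => by
    rw [padEquivFin_zero_val, outEquivFin_zero_val, padRows, getD_map_range _ (ep z).isLt, hep]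
  | j + 1, ⟨Sum.inl (x, cf), h⟩ => by
    have hlt : coefEquivFin en j cf + c ^ (j + 1) * ep ⟨x, h⟩ < d * c ^ (j + 1) :=
      add_mul_lt (ep ⟨x, h⟩).isLt (coefEquivFin en j cf).isLt
    rw [padEquivFin_succ_inl_val, padRows, List.getD_append _ _ _ _ (by simpa using hlt),
      getD_map_range _ hlt]
    change _ = ((outEquivFin em en (j + 1) (Sum.inl (x, cf)) : Fin _) : ℕ)
    rw [outEquivFin_succ_inl_val, ← hep ⟨x, h⟩]
    ring
  | j + 1, ⟨Sum.inr (p, o), h⟩ => by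
    have hlt : (outEquivFin em en j o : ℕ) + outCard r c j * em p < r * outCard r c j :=
      add_mul_lt (em p).isLt (outEquivFin em en j o).isLt
    rw [padEquivFin_succ_inr_val, padRows, List.getD_append_right _ _ _ _ (by simp), List.length_map,
      List.length_range, Nat.add_sub_cancel_left, getD_map_range _ hlt]
    change _ = ((outEquivFin em en (j + 1) (Sum.inr (p, o)) : Fin _) : ℕ)
    rw [outEquivFin_succ_inr_val]
    ring

/-- **The padding block**: `R` rows, one column `Kpad · e_{π t}` per listed row `π t`. [folklore] -/
def padTab (R : ℕ) (π : List ℕ) (Kpad : ℤ) : List (List ℤ) :=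
  tab R π.length fun i t => if i = π.getD t 0 then Kpad else 0

/-- **Horizontal concatenation** of an `R × C₁` and an `R × C₂` window. [folklore] -/
def hcatL (R C₁ C₂ : ℕ) (X Y : List (List ℤ)) : List (List ℤ) :=
  tab R (C₁ + C₂) fun i j => if j < C₁ then ent X i j else ent Y i (j - C₁)

/-- **Transpose** of an `R × C` window (a `C × R` table). [folklore] -/
def trL (R C : ℕ) (X : List (List ℤ)) : List (List ℤ) := tab C R fun i j => ent X j i

/-- Entries of `hcatL`, left block. [folklore] -/
theorem ent_hcatL_left {R C₁ C₂ : ℕ} (X Y : List (List ℤ)) {i j : ℕ} (hi : i < R) (hj : j < C₁) :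
    ent (hcatL R C₁ C₂ X Y) i j = ent X i j := by
  rw [hcatL, ent_tab _ hi (by omega), if_pos hj]

/-- Entries of `hcatL`, right block. [folklore] -/
theorem ent_hcatL_right {R C₁ C₂ : ℕ} (X Y : List (List ℤ)) {i t : ℕ} (hi : i < R) (ht : t < C₂) :
    ent (hcatL R C₁ C₂ X Y) i (C₁ + t) = ent Y i t := by
  rw [hcatL, ent_tab _ hi (by omega), if_neg (by omega), Nat.add_sub_cancel_left]

/-- Entries of `padTab`. [folklore] -/
theorem ent_padTab {R : ℕ} (π : List ℕ) (Kpad : ℤ) {i t : ℕ} (hi : i < R) (ht : t < π.length) :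
    ent (padTab R π Kpad) i t = if i = π.getD t 0 then Kpad else 0 := by
  rw [padTab, ent_tab _ hi ht]

/-- Entries of `trL`. [folklore] -/
theorem ent_trL {R C : ℕ} (X : List (List ℤ)) {i j : ℕ} (hi : i < C) (hj : j < R) :
    ent (trL R C X) i j = ent X j i := by
  rw [trL, ent_tab _ hi hj]

/-- **The output table**: the level-`k` boosted table next to its padding block, transposed — an
`N × N` table, `N = outCard r c k`. [cite: Khot2005, §7.3] -/
def outTab (r c d : ℕ) (B0 : List (List ℤ)) (W Kpad : ℤ) (k : ℕ) : List (List ℤ) :=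
  trL (outCard r c k) (outCard r c k)
    (hcatL (outCard r c k) (c ^ (k + 1)) (padCard r c d k) (augPowTab r c B0 W k)
      (padTab (outCard r c k) (padRows r c d k) Kpad))

variable [Fintype m] [Fintype n] [DecidableEq m] [DecidableEq n]

omit [Fintype m] in
/-- **The output table is the transposed, squared, padded, boosted basis**: for enumerations
`em : m ≃ Fin r`, `en : n ≃ Fin c`, `ep` of the padded base rows with `ep z + 1 = em z`, `c + d = r`,
and a table `B0` holding `B`, `toMat N N (outTab r c d B0 W Kpad k)` is the transpose of
`squareOf (outMatrix B W k p₀ Kpad) eR eC` with `eR = outEquivFin em en k` and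
`eC = (coefEquivFin ⊕ padEquivFin) ≫ finSumFinEquiv ≫ finCongr` (the `eR`, `eC` of `khotDataExplicit`).
[cite: Khot2005, §7.3] -/
theorem toMat_outTab (em : m ≃ Fin r) (en : n ≃ Fin c) {p₀ : m → Prop} [DecidablePred p₀]
    (ep : {x : m // p₀ x} ≃ Fin d) (hep : ∀ z, (ep z : ℕ) + 1 = em z.val) (hcd : c + d = r)
    (B : Matrix m n ℤ) (B0 : List (List ℤ)) (hB : ∀ p i, ent B0 (em p) (en i) = B p i) (W Kpad : ℤ) (k : ℕ) :
    toMat (outCard r c k) (outCard r c k) (outTab r c d B0 W Kpad k) =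
      (squareOf (outMatrix B W k p₀ Kpad) (outEquivFin em en k)
        ((Equiv.sumCongr (coefEquivFin en k) (padEquivFin em en ep k)).trans
          (finSumFinEquiv.trans (finCongr (pow_add_padCard hcd k)))))ᵀ := by
  set eR := outEquivFin em en k with heR
  set eC := (Equiv.sumCongr (coefEquivFin en k) (padEquivFin em en ep k)).trans
    (finSumFinEquiv.trans (finCongr (pow_add_padCard hcd k))) with heC
  -- entries of the un-transposed table through `eR`, `eC`
  have key : ∀ (o : Out m n k) (z : Coef n k ⊕ {o : Out m n k // augPad (n := n) p₀ k o}),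
      ent (hcatL (outCard r c k) (c ^ (k + 1)) (padCard r c d k) (augPowTab r c B0 W k)
        (padTab (outCard r c k) (padRows r c d k) Kpad)) (eR o) (eC z) = outMatrix B W k p₀ Kpad o z := by
    intro o z
    rcases z with cf | pz
    · have hc : (eC (Sum.inl cf) : ℕ) = coefEquivFin en k cf := by simp [heC]
      rw [hc, ent_hcatL_left _ _ (eR o).isLt (coefEquivFin en k cf).isLt, heR, ent_augPowTab em en B B0 hB W k o cf,
        outMatrix, padCols, Matrix.fromCols_apply_inl]
    · have hc : (eC (Sum.inr pz) : ℕ) = c ^ (k + 1) + padEquivFin em en ep k pz := by simp [heC]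
      have hlen := length_padRows r c d k
      rw [hc, ent_hcatL_right _ _ (eR o).isLt (padEquivFin em en ep k pz).isLt,
        ent_padTab _ _ (eR o).isLt ((padEquivFin em en ep k pz).isLt.trans_eq hlen.symm), getD_padRows em en ep hep k pz,
        outMatrix, padCols, Matrix.fromCols_apply_inr, Matrix.of_apply, heR]
      simp only [Fin.val_eq_val, EmbeddingLike.apply_eq_iff_eq]
  ext I J
  obtain ⟨o, rfl⟩ := eR.surjective J
  obtain ⟨z, rfl⟩ := eC.surjective I
  rw [Matrix.transpose_apply, squareOf, Matrix.reindex_apply, Matrix.submatrix_apply, Equiv.symm_apply_apply,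
    Equiv.symm_apply_apply, toMat, outTab, ent_trL _ (eC z).isLt (eR o).isLt, key]

omit [DecidableEq m] in
/-- `growth (augPowMatrix B W k) = growthL` of the level-`k` table. [folklore] -/
theorem growthL_augPowTab (em : m ≃ Fin r) (en : n ≃ Fin c) (B : Matrix m n ℤ) (B0 : List (List ℤ))
    (hB : ∀ p i, ent B0 (em p) (en i) = B p i) (W : ℤ) (k : ℕ) :
    growthL (outCard r c k) (c ^ (k + 1)) (augPowTab r c B0 W k) = growth (augPowMatrix B W k) :=
  growthL_eq_growth (outEquivFin em en k) (coefEquivFin en k) _ _ (ent_augPowTab em en B B0 hB W k)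

end Square

/-! ### Specialisation to Khot's base rows: the padded universe rows -/

section KhotBase

open Params

variable (u σ K k : ℕ)

/-- Universe rows come first: `rowsUnitEquivFin (universe row e) = e`. [folklore] -/
theorem rowsUnitEquivFin_universe (e : Fin u) :
    (rowsUnitEquivFin u σ K k (Sum.inl (Sum.inl (Sum.inl e))) : ℕ) = e := by
  simp [rowsUnitEquivFin, idxR]

variable {u}

/-- The base padding enumeration is `e ↦ e - 1` on the universe rows `e ≠ 0`: `ep z + 1 = em z`.
[folklore] -/
theorem basePadEquivFin_add_one (hu : 1 ≤ u)
    (z : {i : RowsT u σ K k ⊕ Unit // basePad (S := Fin σ) (H := Fin (20 * K) × Fin (MM u σ K k + 1))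
      (Nn := Fin (NN u σ K k)) (⟨0, hu⟩ : Fin u) i}) :
    (basePadEquivFin σ K k hu z : ℕ) + 1 = rowsUnitEquivFin u σ K k z.val := by
  obtain ⟨i, e, rfl, hne⟩ := z
  rw [rowsUnitEquivFin_universe]
  have h0 : (e : ℕ) ≠ 0 := fun h0 => hne (Fin.ext h0)
  simp only [basePadEquivFin, Equiv.coe_fn_mk]
  omega

/-- **The output table of Khot's reduction is correct**: for the explicit data, with `B0` holding the
base basis `B₀` in the orders `rowsUnitEquivFin`/`colsEquivFin`, the table
`outTab (rows+1) cols (u-1) B0 W Kpad k` is the transposed basis of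
`squareOf (outMatrix B₀ W k (basePad 0) Kpad) eR eC` — the basis matrix of the `LatticeInstance`
output by `khotInstance` (column convention). [cite: Khot2005, §7.3] -/
theorem toMat_outTab_explicit (hu : 1 ≤ u) (B₀ : Matrix (RowsT u σ K k ⊕ Unit) (ColsT u σ K k) ℤ)
    (B0 : List (List ℤ)) (hB : ∀ p i, ent B0 (rowsUnitEquivFin u σ K k p) (colsEquivFin u σ K k i) = B₀ p i)
    (W Kpad : ℤ) :
    toMat (NfExplicit u σ K k) (NfExplicit u σ K k) (outTab (rows u σ K k + 1) (cols u σ K k) (u - 1) B0 W Kpad k) =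
      (squareOf (outMatrix B₀ W k (basePad (S := Fin σ) (H := Fin (20 * K) × Fin (MM u σ K k + 1))
        (Nn := Fin (NN u σ K k)) (⟨0, hu⟩ : Fin u)) Kpad)
        ((khotDataExplicit k).eR u σ K) ((khotDataExplicit k).eC u σ K hu))ᵀ :=
  toMat_outTab (rowsUnitEquivFin u σ K k) (colsEquivFin u σ K k) (basePadEquivFin σ K k hu)
    (basePadEquivFin_add_one σ K k hu) (cols_add u σ K k hu) B₀ B0 hB W Kpad k

end KhotBase

end Literature.Algebra.EuclideanLattices.Khot
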